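/-
  Summits/AtomisticToContinuum/Crystallization/Theorems/OverbindingBudgetAffineFarBallBarlowTransfer.lean

  residual stmt-AtomisticToContinuum-31280 · slot Z `FarAggregatePricing 12 (1/25) (1/2000) (1/(2·10⁷))` · leaf LAB₁′
  `ShelteredShellLabelling' (1/25) (1/2000)` (leaf list v14′, critic rows 890/899; engine of record LAB₁′ ⟸ R_aff′ ∧ BBI₀ ∧ G-BBI ∧ CORE
  (+ E4 S-glue), PCR₁ discharged in `…FarKissingRigidity`): ★ G-BBI `BallBarlowTransfer : BallBarlowFact → BarlowBallIdentificationHalf`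
  PROVED OUTRIGHT (critic row 899 (c)(1)).  Literature-only imports.
  decomp-a2c lens-4 «minimal counterexample / extremal reduction», generation 58.  0 sorry · 0 axiom · no instance · no notation · no option.
-/
import Literature.Geometry.DiscreteGeometry.TwoShellPatterns
import Literature.Geometry.DiscreteGeometry.FejesTothKissingTwelve

/-! # G-BBI — the unit-scale, based reading of the ball identification theorem (PROVED)

THE STATEMENTS (verbatim from the g57 engine sketch `bc/EngineSketchV2.lean`, critic row 899 (b)).
* BBI₀ `BallBarlowFact` — the universal closure of the tree theorem `BrittleRungDescentSoftLayerPropagation.ball_barlow` in Literature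
  vocabulary (Hales scale `2`): a unit-ball packing with the `2h₀ = 2.52` gap whose kissing shells within `2R − 2` of `u` are fcc/hcp
  kissing patterns lies, within `R` of `u`, in an isometric image of a Barlow stacking `barlowStacking 2 (2√(2/3)) s` with a Hägg word `s`.
* BBI½ `BarlowBallIdentificationHalf` — the form the LAB₁′ glue consumes (unit scale, based at `0 ∈ Λ`): if every point of `Λ` of norm
  `≤ ρ` carries an exact isometric fcc/hcp TWO-SHELL pattern that is exhaustive within `3/2`, then `Λ ∩ B̄(0, (ρ − ρ₀)/2)` lies in a based
  LINEAR-isometric image `g(· − p₀)` of `barlowStacking 1 √(2/3) s`, `p₀` a stacking point.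
* G-BBI `BallBarlowTransfer := BallBarlowFact → BarlowBallIdentificationHalf`.  ★ PROVED here (`ballBarlowTransfer_holds`, `ρ₀ = 4`).

THE PROOF (memo NODE-g57 §2, executed).  Apply BBI₀ to the doubled ball `V := 2 • (Λ ∩ B̄(0, ρ))`, `u := 0`, `R := ρ`:
* §1 PATTERN BOOKKEEPING: the unit vectors of `fcc/hcpTwoShellPattern` are exactly `fcc/hcpKissingPattern` (the second shells have
  norm `√2 ≠ 1`; integer arithmetic `decide` on the models of `Literature…TwoShellPatterns`); every pattern vector has norm `1` or `√2`.
* §2 SCALING: `barlowPos 2 (2𝗁) s k i j = 2 • barlowPos 1 𝗁 s k i j` (coordinates), so halving maps `barlowStacking 2 (2√(2/3)) s` into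
  `barlowStacking 1 √(2/3) s`.
* §3 THE DOUBLED BALL: exhaustiveness within `3/2` puts every distance from a point of norm `≤ ρ` to another point of `Λ` in
  `{1, √2} ∪ (3/2, ∞)`, whence `V` is a unit-ball packing with the `2h₀ ≤ 2√2 < 3` gap; for `‖x‖ + 1 ≤ ρ` the kissing shell of `2x` in
  `V` is `2A(P ∩ S²(1)) = 2A(kissing pattern)`, i.e. `IsArrangedIn`.
* §4 MAZUR–ULAM: the isometry `g` of BBI₀ is affine (`IsometryEquiv.toRealAffineIsometryEquiv`); `0 ∈ Λ` gives `0 = g q₀` with `q₀` in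
  the stacking, and `2x = g q` gives `x = L(q/2 − q₀/2)` with `L` the linear part; `p₀ := q₀/2`.
RADIUS: complete kissing shells are available for `‖x‖ < ρ − 1` (`dist 0 (2x) < 2R − 2`) and the identification covers `‖2x‖ ≤ ρ`, i.e.
`‖x‖ ≤ ρ/2 ⊇ ‖x‖ ≤ (ρ − 4)/2` — the halving found in F-BBI (critic row 899 (b)); `4 ≤ ρ` is BBI₀'s `4 ≤ R`.
HIDDEN-GAUGE / DEGENERATE AUDIT: BBI₀ is used once, at `(V, 0, ρ)`; no property of `Λ` beyond `0 ∈ Λ` and the two-shell clause at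
points of norm `≤ ρ` is used; the conclusion's `g` is a `LinearIsometryEquiv` (no translation part left: it is absorbed by `p₀`); the
patterns enter only through their norms (`1`, `√2`) and the inclusion kissing ⊆ two-shell; no choice beyond BBI₀'s `(s, g)` and preimages.
-/

namespace Summit.AtomisticToContinuum.Crystallization.Theorems.OverbindingBudgetAffineFarSmoothSplit

open Literature.MathematicalPhysics.StatisticalMechanics
open Literature.Geometry.DiscreteGeometry

/-! ## §0  The statements BBI₀, BBI½, G-BBI (verbatim from the g57 engine sketch) -/

/-- **BBI₀ · `BallBarlowFact`** (engine input E2a; = the universal closure of the TREE theorem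
`BrittleRungDescentSoftLayerPropagation.ball_barlow`, VERBATIM, in Literature vocabulary; Hales scale `2`): a unit-ball packing with
the `2h₀` gap whose kissing shells within `2R − 2` of `u` are fcc/hcp kissing patterns lies, within `R` of `u`, in an isometric image of
a Barlow stacking with a Hägg word.  Port·S once the tree module builds (`fun _ hV hsep _ _ hR hpat => ball_barlow hV hsep hR hpat`).
[this file] -/
def BallBarlowFact : Prop :=
  ∀ (V : Set (EuclideanSpace ℝ (Fin 3))), IsUnitBallPacking V →
    (∀ x ∈ V, ∀ y ∈ V, x = y ∨ dist x y = 2 ∨ 2 * hales_h0 ≤ dist x y) →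
    ∀ (u : EuclideanSpace ℝ (Fin 3)) (R : ℝ), 4 ≤ R →
      (∀ v ∈ V, dist u v < 2 * R - 2 →
        IsArrangedIn (kissingShell V v) fccKissingPattern ∨ IsArrangedIn (kissingShell V v) hcpKissingPattern) →
      ∃ s : ℤ → ℤ, IsHaggSeq s ∧ ∃ g : EuclideanSpace ℝ (Fin 3) ≃ᵢ EuclideanSpace ℝ (Fin 3),
        ∀ v ∈ V, dist u v ≤ R → v ∈ g '' barlowStacking 2 (2 * Real.sqrt (2 / 3)) s

/-- **BBI½ · `BarlowBallIdentificationHalf`** (engine input E2, the form LAB₁′'s glue consumes; unit scale, BASED at `0`): a point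
set `Λ ∋ 0` in which every point of norm `≤ ρ` carries an exact isometric fcc/hcp two-shell pattern, exhaustive within `3/2`, is, on
the ball of radius `(ρ − ρ₀)/2`, contained in a based LINEAR-isometric image of a Barlow stacking with a Hägg word.  PROVED from BBI₀
(`barlowBallIdentificationHalf_of_ballBarlowFact`, `ρ₀ = 4`). [this file] -/
def BarlowBallIdentificationHalf : Prop :=
  ∃ ρ₀ : ℝ, 0 ≤ ρ₀ ∧ ∀ (Λ : Set (EuclideanSpace ℝ (Fin 3))) (ρ : ℝ), ρ₀ ≤ ρ → (0 : EuclideanSpace ℝ (Fin 3)) ∈ Λ →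
    (∀ x ∈ Λ, ‖x‖ ≤ ρ →
      ∃ (A : EuclideanSpace ℝ (Fin 3) →ₗᵢ[ℝ] EuclideanSpace ℝ (Fin 3)) (P : Finset (EuclideanSpace ℝ (Fin 3))),
        (P = fccTwoShellPattern ∨ P = hcpTwoShellPattern) ∧ (∀ v ∈ P, x + A v ∈ Λ) ∧
        ∀ x' ∈ Λ, x' ≠ x → dist x' x ≤ 3 / 2 → ∃ v ∈ P, x' = x + A v) →
    ∃ (s : ℤ → ℤ) (g : EuclideanSpace ℝ (Fin 3) ≃ₗᵢ[ℝ] EuclideanSpace ℝ (Fin 3)) (p₀ : EuclideanSpace ℝ (Fin 3)),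
      IsHaggSeq s ∧ p₀ ∈ barlowStacking 1 (Real.sqrt (2 / 3)) s ∧
      ∀ x ∈ Λ, ‖x‖ ≤ (ρ - ρ₀) / 2 → ∃ p ∈ barlowStacking 1 (Real.sqrt (2 / 3)) s, x = g (p - p₀)

/-- **G-BBI · `BallBarlowTransfer`** (engine glue E2b): BBI₀ ⇒ BBI½.  ★ PROVED (`ballBarlowTransfer_holds`). [this file] -/
def BallBarlowTransfer : Prop := BallBarlowFact → BarlowBallIdentificationHalf

/-! ## §1  Pattern bookkeeping: the unit vectors of a two-shell pattern are the kissing pattern -/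

/-- The fcc two-shell pattern is the kissing pattern together with the scaled second shell. [this file] -/
theorem fccTwoShellPattern_eq_union :
    fccTwoShellPattern = fccKissingPattern ∪ scaledPattern fccSecondShellInt 2 := by
  simp only [fccTwoShellPattern, fccKissingPattern, scaledPattern, Finset.image_union]

/-- The hcp two-shell pattern is the kissing pattern together with the scaled second shell. [this file] -/
theorem hcpTwoShellPattern_eq_union :
    hcpTwoShellPattern = hcpKissingPattern ∪ scaledPattern hcpSecondShellInt 18 := by
  simp only [hcpTwoShellPattern, hcpKissingPattern, scaledPattern, Finset.image_union]

/-- The fcc second shell has norm `√2`. [this file] -/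
theorem norm_of_mem_fccSecondShell {y : EuclideanSpace ℝ (Fin 3)} (hy : y ∈ scaledPattern fccSecondShellInt 2) :
    ‖y‖ = Real.sqrt 2 := by
  obtain ⟨v, hv, hn⟩ := norm_of_mem_scaledPattern two_ne_zero hy
  rw [hn, (by decide : ∀ v ∈ fccSecondShellInt, sqNormInt v = 4) v hv]
  norm_num

/-- The hcp second shell has norm `√2`. [this file] -/
theorem norm_of_mem_hcpSecondShell {y : EuclideanSpace ℝ (Fin 3)} (hy : y ∈ scaledPattern hcpSecondShellInt 18) :
    ‖y‖ = Real.sqrt 2 := by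
  obtain ⟨v, hv, hn⟩ := norm_of_mem_scaledPattern (by norm_num) hy
  rw [hn, (by decide : ∀ v ∈ hcpSecondShellInt, sqNormInt v = 36) v hv]
  norm_num

/-- **The unit vectors of the fcc two-shell pattern are exactly the fcc kissing pattern.** [this file] -/
theorem mem_fccTwoShellPattern_and_norm_eq_one_iff (y : EuclideanSpace ℝ (Fin 3)) :
    y ∈ fccTwoShellPattern ∧ ‖y‖ = 1 ↔ y ∈ fccKissingPattern := by
  constructor
  · rintro ⟨hy, h1⟩
    rw [fccTwoShellPattern_eq_union, Finset.mem_union] at hy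
    rcases hy with hy | hy
    · exact hy
    · exact absurd ((norm_of_mem_fccSecondShell hy).symm.trans h1) (fun h : Real.sqrt 2 = 1 => by have h2 : Real.sqrt 2 ^ 2 = 2 := Real.sq_sqrt (by norm_num); rw [h] at h2; norm_num at h2)
  · intro hy
    exact ⟨fccKissingPattern_subset hy, norm_eq_one_of_mem_fccKissingPattern hy⟩

/-- **The unit vectors of the hcp two-shell pattern are exactly the hcp kissing pattern.** [this file] -/
theorem mem_hcpTwoShellPattern_and_norm_eq_one_iff (y : EuclideanSpace ℝ (Fin 3)) :
    y ∈ hcpTwoShellPattern ∧ ‖y‖ = 1 ↔ y ∈ hcpKissingPattern := by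
  constructor
  · rintro ⟨hy, h1⟩
    rw [hcpTwoShellPattern_eq_union, Finset.mem_union] at hy
    rcases hy with hy | hy
    · exact hy
    · exact absurd ((norm_of_mem_hcpSecondShell hy).symm.trans h1) (fun h : Real.sqrt 2 = 1 => by have h2 : Real.sqrt 2 ^ 2 = 2 := Real.sq_sqrt (by norm_num); rw [h] at h2; norm_num at h2)
  · intro hy
    exact ⟨hcpKissingPattern_subset hy, norm_eq_one_of_mem_hcpKissingPattern hy⟩

/-! ## §2  Scaling of Barlow stackings -/

/-- **Homogeneity of `barlowPos` in the two spacings**: doubling both spacings doubles every stacking point. [this file] -/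
theorem barlowPos_two_eq_two_smul (h : ℝ) (s : ℤ → ℤ) (k i j : ℤ) :
    barlowPos 2 (2 * h) s k i j = (2 : ℝ) • barlowPos 1 h s k i j := by
  ext l
  fin_cases l <;> simp <;> ring

/-- Halving maps the Hales-scale stacking `barlowStacking 2 (2𝗁) s` into the unit-scale stacking `barlowStacking 1 𝗁 s`. [this file] -/
theorem half_smul_mem_barlowStacking {h : ℝ} {s : ℤ → ℤ} {q : EuclideanSpace ℝ (Fin 3)}
    (hq : q ∈ barlowStacking 2 (2 * h) s) : (1 / 2 : ℝ) • q ∈ barlowStacking 1 h s := by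
  obtain ⟨k, i, j, rfl⟩ := hq
  refine ⟨k, i, j, ?_⟩
  rw [barlowPos_two_eq_two_smul, smul_smul]
  norm_num

/-! ## §3  The doubled ball `2 • (Λ ∩ B̄(0, ρ))` as a Hales-scale packing -/

/-- The doubled ball `V := 2 • (Λ ∩ B̄(0, ρ))` (Hales scale: nearest neighbours at distance `2`). [this file] -/
def doubledBall (Λ : Set (EuclideanSpace ℝ (Fin 3))) (ρ : ℝ) : Set (EuclideanSpace ℝ (Fin 3)) :=
  (fun x => (2 : ℝ) • x) '' (Λ ∩ Metric.closedBall 0 ρ)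

/-- Membership in the doubled ball. [this file] -/
theorem mem_doubledBall_iff {Λ : Set (EuclideanSpace ℝ (Fin 3))} {ρ : ℝ} {z : EuclideanSpace ℝ (Fin 3)} :
    z ∈ doubledBall Λ ρ ↔ ∃ y, (y ∈ Λ ∧ ‖y‖ ≤ ρ) ∧ (2 : ℝ) • y = z := by
  simp only [doubledBall, Set.mem_image, Set.mem_inter_iff, mem_closedBall_zero_iff]

/-- Points of `Λ` of norm `≤ ρ` double into the doubled ball. [this file] -/
theorem two_smul_mem_doubledBall {Λ : Set (EuclideanSpace ℝ (Fin 3))} {ρ : ℝ} {x : EuclideanSpace ℝ (Fin 3)}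
    (hx : x ∈ Λ) (hxρ : ‖x‖ ≤ ρ) : (2 : ℝ) • x ∈ doubledBall Λ ρ :=
  mem_doubledBall_iff.2 ⟨x, ⟨hx, hxρ⟩, rfl⟩

/-- **Distance trichotomy from an exhaustive exact two-shell pattern**: another point of `Λ` is at distance `1`, `√2`, or `> 3/2`.
[this file] -/
theorem dist_cases_of_twoShell {Λ : Set (EuclideanSpace ℝ (Fin 3))} {x x' : EuclideanSpace ℝ (Fin 3)}
    {A : EuclideanSpace ℝ (Fin 3) →ₗᵢ[ℝ] EuclideanSpace ℝ (Fin 3)} {P : Finset (EuclideanSpace ℝ (Fin 3))}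
    (hP : P = fccTwoShellPattern ∨ P = hcpTwoShellPattern)
    (hexh : ∀ x' ∈ Λ, x' ≠ x → dist x' x ≤ 3 / 2 → ∃ v ∈ P, x' = x + A v)
    (hx' : x' ∈ Λ) (hne : x' ≠ x) :
    dist x' x = 1 ∨ dist x' x = Real.sqrt 2 ∨ 3 / 2 < dist x' x := by
  by_cases hd : dist x' x ≤ 3 / 2
  · obtain ⟨v, hv, rfl⟩ := hexh x' hx' hne hd
    rw [dist_eq_norm, add_sub_cancel_left, A.norm_map]
    have hnorm : ‖v‖ = 1 ∨ ‖v‖ = Real.sqrt 2 := by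
      rcases hP with rfl | rfl
      exacts [norm_of_mem_fccTwoShellPattern hv, norm_of_mem_hcpTwoShellPattern hv]
    rcases hnorm with h | h
    · exact Or.inl h
    · exact Or.inr (Or.inl h)
  · exact Or.inr (Or.inr (not_le.1 hd))

/-- In particular distinct points are at distance `≥ 1`. [this file] -/
theorem one_le_dist_of_twoShell {Λ : Set (EuclideanSpace ℝ (Fin 3))} {x x' : EuclideanSpace ℝ (Fin 3)}
    {A : EuclideanSpace ℝ (Fin 3) →ₗᵢ[ℝ] EuclideanSpace ℝ (Fin 3)} {P : Finset (EuclideanSpace ℝ (Fin 3))}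
    (hP : P = fccTwoShellPattern ∨ P = hcpTwoShellPattern)
    (hexh : ∀ x' ∈ Λ, x' ≠ x → dist x' x ≤ 3 / 2 → ∃ v ∈ P, x' = x + A v)
    (hx' : x' ∈ Λ) (hne : x' ≠ x) : 1 ≤ dist x' x := by
  rcases dist_cases_of_twoShell hP hexh hx' hne with h | h | h
  · rw [h]
  · rw [h]
    exact Real.one_le_sqrt.mpr (by norm_num)
  · linarith

section Doubled

variable {Λ : Set (EuclideanSpace ℝ (Fin 3))} {ρ : ℝ}
  (hshell : ∀ x ∈ Λ, ‖x‖ ≤ ρ →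
    ∃ (A : EuclideanSpace ℝ (Fin 3) →ₗᵢ[ℝ] EuclideanSpace ℝ (Fin 3)) (P : Finset (EuclideanSpace ℝ (Fin 3))),
      (P = fccTwoShellPattern ∨ P = hcpTwoShellPattern) ∧ (∀ v ∈ P, x + A v ∈ Λ) ∧
      ∀ x' ∈ Λ, x' ≠ x → dist x' x ≤ 3 / 2 → ∃ v ∈ P, x' = x + A v)
include hshell

/-- **The doubled ball is a packing of unit balls** (distinct points of `Λ ∩ B̄(0, ρ)` are `≥ 1` apart). [this file] -/
theorem isUnitBallPacking_doubledBall : IsUnitBallPacking (doubledBall Λ ρ) := by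
  intro z hz z' hz' hd
  obtain ⟨x, ⟨hxΛ, hxρ⟩, rfl⟩ := mem_doubledBall_iff.1 hz
  obtain ⟨y, ⟨hyΛ, -⟩, rfl⟩ := mem_doubledBall_iff.1 hz'
  by_contra hne
  have hne' : y ≠ x := fun h => hne (by rw [h])
  obtain ⟨A, P, hP, -, hexh⟩ := hshell x hxΛ hxρ
  have h1 : 1 ≤ dist y x := one_le_dist_of_twoShell hP hexh hyΛ hne'
  rw [dist_smul₀, Real.norm_two, dist_comm] at hd
  linarith

/-- **The doubled ball has Hales's `2h₀` gap**: distinct points are at distance `2` or `≥ 2√2 ≥ 2.52`. [this file] -/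
theorem gap_doubledBall :
    ∀ z ∈ doubledBall Λ ρ, ∀ z' ∈ doubledBall Λ ρ, z = z' ∨ dist z z' = 2 ∨ 2 * hales_h0 ≤ dist z z' := by
  intro z hz z' hz'
  obtain ⟨x, ⟨hxΛ, hxρ⟩, rfl⟩ := mem_doubledBall_iff.1 hz
  obtain ⟨y, ⟨hyΛ, -⟩, rfl⟩ := mem_doubledBall_iff.1 hz'
  by_cases hxy : y = x
  · exact Or.inl (by rw [hxy])
  right
  obtain ⟨A, P, hP, -, hexh⟩ := hshell x hxΛ hxρ
  rw [dist_smul₀, Real.norm_two, dist_comm]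
  rcases dist_cases_of_twoShell hP hexh hyΛ hxy with h | h | h
  · left
    rw [h, mul_one]
  · right
    rw [h]
    exact two_mul_hales_h0_le
  · right
    rw [hales_h0_eq]
    linarith

omit hshell in
/-- **The kissing shells of the doubled ball**: for `‖x‖ + 1 ≤ ρ`, the kissing shell of `2x` is `2A(P ∩ S²(1))`, written with the
kissing pattern `K` of `P` (`hK`). [this file] -/
theorem kissingShell_doubledBall_eq {x : EuclideanSpace ℝ (Fin 3)} (A : EuclideanSpace ℝ (Fin 3) →ₗᵢ[ℝ] EuclideanSpace ℝ (Fin 3))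
    {P K : Finset (EuclideanSpace ℝ (Fin 3))} (hK : ∀ y, y ∈ P ∧ ‖y‖ = 1 ↔ y ∈ K)
    (hmem : ∀ v ∈ P, x + A v ∈ Λ) (hexh : ∀ x' ∈ Λ, x' ≠ x → dist x' x ≤ 3 / 2 → ∃ v ∈ P, x' = x + A v)
    (hx : ‖x‖ + 1 ≤ ρ) :
    kissingShell (doubledBall Λ ρ) ((2 : ℝ) • x) = (fun p => (2 : ℝ) • A p) '' (K : Set (EuclideanSpace ℝ (Fin 3))) := by
  ext z
  rw [mem_kissingShell_iff]
  constructor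
  · rintro ⟨hzV, hz⟩
    obtain ⟨y, ⟨hyΛ, -⟩, hy⟩ := mem_doubledBall_iff.1 hzV
    have hz' : z = (2 : ℝ) • (y - x) := by rw [smul_sub, hy, add_sub_cancel_left]
    have hyx : ‖y - x‖ = 1 := by
      have h2 := hz
      rw [hz', norm_smul, Real.norm_two] at h2
      linarith
    have hne : y ≠ x := by
      intro h
      rw [h, sub_self, norm_zero] at hyx
      exact zero_ne_one hyx
    obtain ⟨v, hv, hyv⟩ := hexh y hyΛ hne (by rw [dist_eq_norm, hyx]; norm_num)
    have hAv : y - x = A v := by rw [hyv, add_sub_cancel_left]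
    have hv1 : ‖v‖ = 1 := by rw [← A.norm_map, ← hAv, hyx]
    refine ⟨v, (hK v).1 ⟨hv, hv1⟩, ?_⟩
    show (2 : ℝ) • A v = z
    rw [hz', hAv]
  · rintro ⟨v, hvK, rfl⟩
    obtain ⟨hvP, hv1⟩ := (hK v).2 hvK
    refine ⟨mem_doubledBall_iff.2 ⟨x + A v, ⟨hmem v hvP, ?_⟩, by rw [smul_add]⟩, ?_⟩
    · calc ‖x + A v‖ ≤ ‖x‖ + ‖A v‖ := norm_add_le _ _
        _ = ‖x‖ + 1 := by rw [A.norm_map, hv1]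
        _ ≤ ρ := hx
    · show ‖(2 : ℝ) • A v‖ = 2
      rw [norm_smul, Real.norm_two, A.norm_map, hv1, mul_one]

/-- **The kissing shells of the doubled ball deep inside are fcc/hcp kissing patterns** (for `dist 0 z < 2ρ − 2`). [this file] -/
theorem isArrangedIn_kissingShell_doubledBall {z : EuclideanSpace ℝ (Fin 3)} (hz : z ∈ doubledBall Λ ρ)
    (hd : dist 0 z < 2 * ρ - 2) :
    IsArrangedIn (kissingShell (doubledBall Λ ρ) z) fccKissingPattern ∨
      IsArrangedIn (kissingShell (doubledBall Λ ρ) z) hcpKissingPattern := by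
  obtain ⟨x, ⟨hxΛ, hxρ⟩, rfl⟩ := mem_doubledBall_iff.1 hz
  have hx : ‖x‖ + 1 ≤ ρ := by
    rw [dist_comm, dist_zero_right, norm_smul, Real.norm_two] at hd
    linarith
  obtain ⟨A, P, hP, hmem, hexh⟩ := hshell x hxΛ hxρ
  rcases hP with rfl | rfl
  · exact Or.inl ⟨A, kissingShell_doubledBall_eq A mem_fccTwoShellPattern_and_norm_eq_one_iff hmem hexh hx⟩
  · exact Or.inr ⟨A, kissingShell_doubledBall_eq A mem_hcpTwoShellPattern_and_norm_eq_one_iff hmem hexh hx⟩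

end Doubled

/-! ## §4  ★ G-BBI (PROVED): Mazur–Ulam, base point, halving -/

/-- **BBI₀ ⇒ BBI½ with `ρ₀ = 4`.** [this file] -/
theorem barlowBallIdentificationHalf_of_ballBarlowFact (hBB : BallBarlowFact) : BarlowBallIdentificationHalf := by
  refine ⟨4, by norm_num, ?_⟩
  intro Λ ρ hρ h0 hshell
  have hpack := isUnitBallPacking_doubledBall hshell
  have hgap := gap_doubledBall hshell
  have hpat : ∀ v ∈ doubledBall Λ ρ, dist 0 v < 2 * ρ - 2 →
      IsArrangedIn (kissingShell (doubledBall Λ ρ) v) fccKissingPattern ∨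
        IsArrangedIn (kissingShell (doubledBall Λ ρ) v) hcpKissingPattern :=
    fun v hv hd => isArrangedIn_kissingShell_doubledBall hshell hv hd
  obtain ⟨s, hs, g, hg⟩ := hBB (doubledBall Λ ρ) hpack hgap 0 ρ hρ hpat
  -- the base point: `0 ∈ Λ` doubles to `0 ∈ V`, which is `g q₀`
  have h0V : (0 : EuclideanSpace ℝ (Fin 3)) ∈ doubledBall Λ ρ := by
    have h := two_smul_mem_doubledBall h0 (show ‖(0 : EuclideanSpace ℝ (Fin 3))‖ ≤ ρ by rw [norm_zero]; linarith)
    rwa [smul_zero] at h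
  obtain ⟨q₀, hq₀, hgq₀⟩ := hg 0 h0V (by rw [dist_self]; linarith)
  refine ⟨s, g.toRealAffineIsometryEquiv.linearIsometryEquiv, (1 / 2 : ℝ) • q₀, hs, half_smul_mem_barlowStacking hq₀, ?_⟩
  intro x hxΛ hxn
  have hxρ : ‖x‖ ≤ ρ := by linarith [norm_nonneg x]
  have hd : dist (0 : EuclideanSpace ℝ (Fin 3)) ((2 : ℝ) • x) ≤ ρ := by
    rw [dist_comm, dist_zero_right, norm_smul, Real.norm_two]
    linarith
  obtain ⟨q, hq, hgq⟩ := hg _ (two_smul_mem_doubledBall hxΛ hxρ) hd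
  refine ⟨(1 / 2 : ℝ) • q, half_smul_mem_barlowStacking hq, ?_⟩
  have key : g.toRealAffineIsometryEquiv.linearIsometryEquiv (q - q₀) = (2 : ℝ) • x := by
    have h := g.toRealAffineIsometryEquiv.map_vsub q q₀
    rw [vsub_eq_sub, vsub_eq_sub] at h
    rw [h]
    show g q - g q₀ = (2 : ℝ) • x
    rw [hgq, hgq₀, sub_zero]
  calc x = (1 / 2 : ℝ) • ((2 : ℝ) • x) := by rw [smul_smul]; norm_num
    _ = (1 / 2 : ℝ) • g.toRealAffineIsometryEquiv.linearIsometryEquiv (q - q₀) := by rw [key]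
    _ = g.toRealAffineIsometryEquiv.linearIsometryEquiv ((1 / 2 : ℝ) • q - (1 / 2 : ℝ) • q₀) := by
        rw [← smul_sub, LinearIsometryEquiv.map_smul]

/-- ★ **G-BBI `BallBarlowTransfer` (PROVED).** [this file] -/
theorem ballBarlowTransfer_holds : BallBarlowTransfer :=
  barlowBallIdentificationHalf_of_ballBarlowFact

end Summit.AtomisticToContinuum.Crystallization.Theorems.OverbindingBudgetAffineFarSmoothSplit
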